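import Literature.NumberTheory.Automorphic.LocalLanglandsDatum
import Literature.NumberTheory.Automorphic.LocalLanglandsGLOne
import Literature.NumberTheory.Automorphic.GL2RSLFactorCharacter
import Literature.NumberTheory.Automorphic.TateLocalZetaShells
import Literature.NumberTheory.Automorphic.TateGaussSums
import HarnessLib

/-!
# (C2) `stub_local1951_llc`: reading a conductor-one Galois shape through the typed local
# Langlands correspondence (crux stmt-Langlands-15898, line `Sketch`, stub `stub_levelOne_local1951`)

Let `F` be a non-archimedean local field, `d : LocalLanglandsDatum F` a local Langlands datum
(`recGL`, local Artin datum `d.artin`, the six clauses `IsLocalLanglandsGL`), `π_v` an irreducible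
smooth `ψ`-generic representation of `GL₂(F)` whose parameter `d.recGL 2 ⟦π_v⟧` is the class of a
Frobenius-semisimple `r'` with `N = 0` and `r'.ρ = ψ₁ ⊕ ψ₂` on a basis `b` of `ℂ²`, `ψ₁`
unramified, `ψ₂` ramified of finite order `m` prime to `p` on inertia; assume `U¹_F` is pro-`p`
(elementwise).  We prove (`stub_local1951_llc`): there is a character `χ : Fˣ →* ℂˣ`, trivial on
`U¹`, non-trivial on `U⁰ = 𝒪ˣ`, such that for every invariant measure `ν` on `GL₁(F) ⧸ U₁` the
JPSS polynomials of `π_v × 1` and of `π_v × χ⁻¹` have degree `≥ 1`.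

Proof.  `ψ₂` is trivial on the open subgroup of inertia on which `r'.ρ` is trivial, so it is a
continuous character of `W_F` and factors as `χ ∘ artin` through the local Artin map (local class
field theory for `GL₁`, `LocalArtinData.recGL1_surjective`).  As `artin(I_F) = 𝒪ˣ`
(`image_inertia`), `χ` is non-trivial on `U⁰` and `χ(U¹) ⊆ ψ₂(I_F)` is killed by `m`; `ker χ` is
open (`d.hqc`), so it contains some `U^N`, and the pro-`p` hypothesis gives `χ(x)^{p^a} = 1` for
`x ∈ U¹`; since `gcd(p^a, m) = 1`, `χ(x) = 1`.  For the degrees, clause (iii-L) `lFactor_pairs` of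
`d` at the pair `(π_v, χ' ∘ det)` (`χ' = 1`, resp. `χ' = χ⁻¹`; every representation of `GL₁` is
generic) says that the JPSS polynomial is the Euler factor `det(1 - TΦ | (ker N)^{I})` of
`A₀ ⊗ B₀`, `A₀ = (d.recGL 2 ⟦π_v⟧).out ≅ r'`, `B₀ = (d.recGL 1 ⟦χ' ∘ det⟧).out ≅ (χ' ∘ artin, 0)`
(clause (ii) `gl_one`); its degree is `dim (ker N)^{I}` (the restricted Frobenius is invertible),
and `(ker N)^{I}` contains the line spanned by the image of `b 0 ⊗ 1` (resp. `b 1 ⊗ 1`), on which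
inertia acts by `ψ₁|_I · 1 = 1` (resp. `ψ₂|_I · ψ₂|_I⁻¹ = 1`).

References: Harris–Taylor 2001, Thm. A (ii), (v); Jacquet–Piatetski-Shapiro–Shalika 1983,
Thm. 2.7; Tate, Corvallis 1979, (1.4.5), (4.1.6); Serre, Local Fields, XV §2.
-/

set_option linter.dupNamespace false -- project-wide option (lakefile weak.linter.dupNamespace); `Summit.Langlands.Langlands` is the mandated namespace

noncomputable section

open scoped MatrixGroups Matrix TensorProduct Polynomial Topology
open Literature.NumberTheory.Automorphic Literature.NumberTheory.GaloisRepresentations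
  Polynomial MeasureTheory Module
open Literature.NumberTheory.GaloisRepresentations.IsNonarchimedeanLocalField
open Field ValuativeRel

namespace Summit.Langlands.Langlands.Theorems.CorrespondentFingerprint

/-! ### Weil–Deligne linear algebra: the degree of the Euler factor -/

/-- **`deg det(1 - TΦ | (ker N)^{I}) = dim (ker N)^{I}`**: the Euler factor is the reversed
characteristic polynomial of the INVERTIBLE operator `ρ(Φ)|_{(ker N)^{I_F}}`, whose characteristic
polynomial has non-zero constant term, so reversing does not drop the degree.
[cite: TateCorvallis1979, (4.1.6)] -/
private theorem natDegree_eulerFactor_eq_finrank {F : Type} [Field F] [ValuativeRel F]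
    [TopologicalSpace F] [IsNonarchimedeanLocalField F] {C : Type*} [Field C] [CharZero C]
    {V : Type*} [AddCommGroup V] [Module C V] [FiniteDimensional C V]
    (r : WeilDeligneRep F C V) (hn : absInertia_normal F) (hex : exists_isFrobPow (F := F)) :
    (r.eulerFactor hn hex).natDegree = finrank C r.inertiaInvariantsKerN := by
  classical
  unfold WeilDeligneRep.eulerFactor
  set b := Module.finBasis C r.inertiaInvariantsKerN with hb
  set e := r.restrictInertiaInvariantsKerN hn (WeilDeligneRep.geomFrob F hex) with he
  set M := LinearMap.toMatrix b b e with hM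
  -- `ρ(Φ)|` is invertible, with inverse `ρ(Φ⁻¹)|`
  have hunit : IsUnit e := by
    refine ⟨⟨e, r.restrictInertiaInvariantsKerN hn (WeilDeligneRep.geomFrob F hex)⁻¹, ?_, ?_⟩, rfl⟩
    · refine LinearMap.ext fun v => Subtype.ext ?_
      rw [Module.End.mul_apply, he, WeilDeligneRep.coe_restrictInertiaInvariantsKerN_apply,
        WeilDeligneRep.coe_restrictInertiaInvariantsKerN_apply, ← Module.End.mul_apply, ← map_mul,
        mul_inv_cancel, map_one, Module.End.one_apply, Module.End.one_apply]
    · refine LinearMap.ext fun v => Subtype.ext ?_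
      rw [Module.End.mul_apply, he, WeilDeligneRep.coe_restrictInertiaInvariantsKerN_apply,
        WeilDeligneRep.coe_restrictInertiaInvariantsKerN_apply, ← Module.End.mul_apply, ← map_mul,
        inv_mul_cancel, map_one, Module.End.one_apply, Module.End.one_apply]
  have hdet : M.det ≠ 0 := by
    rw [hM, LinearMap.det_toMatrix]
    exact (hunit.map LinearMap.det).ne_zero
  have h0 : M.charpoly.coeff 0 ≠ 0 := by
    intro h
    apply hdet
    rw [Matrix.det_eq_sign_charpoly_coeff, h, mul_zero]
  have htr : M.charpoly.natTrailingDegree = 0 :=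
    Polynomial.natTrailingDegree_eq_zero_of_constantCoeff_ne_zero h0
  have hdeg := Polynomial.natDegree_eq_reverse_natDegree_add_natTrailingDegree M.charpoly
  rw [htr, add_zero, Matrix.charpoly_natDegree_eq_dim, Fintype.card_fin] at hdeg
  rw [← Matrix.reverse_charpoly, ← hdeg]

/-- **A non-zero vector of `(ker N)^{I}` forces `deg det(1 - TΦ | (ker N)^{I}) ≥ 1`.**
[cite: TateCorvallis1979, (4.1.6)] -/
private theorem one_le_natDegree_eulerFactor {F : Type} [Field F] [ValuativeRel F]
    [TopologicalSpace F] [IsNonarchimedeanLocalField F] {C : Type*} [Field C] [CharZero C]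
    {V : Type*} [AddCommGroup V] [Module C V] [FiniteDimensional C V]
    (r : WeilDeligneRep F C V) (hn : absInertia_normal F) (hex : exists_isFrobPow (F := F))
    {v : V} (hv : v ∈ r.inertiaInvariantsKerN) (hv0 : v ≠ 0) :
    1 ≤ (r.eulerFactor hn hex).natDegree := by
  rw [natDegree_eulerFactor_eq_finrank, Submodule.one_le_finrank_iff, Submodule.ne_bot_iff]
  exact ⟨v, hv, hv0⟩

/-! ### The transfer through `lFactor_pairs` and `gl_one` -/

/-- **`deg L(s, π_v × χ') ≥ 1` from an inertia-invariant line of `r' ⊗ (χ' ∘ artin)`.**  Let `d` be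
a local Langlands datum, `π_v` irreducible smooth `ψ`-generic on `GL₂(F)` with
`d.recGL 2 ⟦π_v⟧ = ⟦r'⟧`, `r'.N = 0`; let `π'` be an irreducible smooth representation of `GL₁(F)`
acting through the quasi-character `χ' ∘ det`, and `x ≠ 0` a vector of `ℂ²` on which `W_F` acts via
`r'.ρ` through a character `θ` with `θ(u) χ'(artin u) = 1` for `u ∈ I_F`.  Then for every invariant
measure `ν` the JPSS polynomial `P₀` of `π_v × π'` exists and `deg P₀ ≥ 1`: by (iii-L) `P₀` is the
Euler factor of `A₀ ⊗ B₀` with `A₀ = (d.recGL 2 ⟦π_v⟧).out ≅ r'` and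
`B₀ = (d.recGL 1 ⟦π'⟧).out ≅ (χ' ∘ artin, 0)` (clause (ii)), and the image of `x ⊗ 1` is a
non-zero vector of `(ker N)^{I}`. [cite: HarrisTaylorAMS2001, Thm. A (ii), (v)]
[cite: JacquetPiatetskiShapiroShalika1983, Thm. 2.7 (i)–(ii)] [cite: TateCorvallis1979, (4.1.6)] -/
private theorem exists_hasRSLFactor_one_le {F : Type} [Field F] [ValuativeRel F]
    [TopologicalSpace F] [IsNonarchimedeanLocalField F] (d : LocalLanglandsDatum F)
    (πv : SmoothIrrep (GL (Fin 2) F)) (ψ : AddChar F Circle) (hψ : ψ.IsContinuousNontrivial)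
    (hgen : IsGeneric πv.ρ ψ) (r' : WeilDeligneRep F ℂ (Fin 2 → ℂ)) (hr' : r'.IsFrobSemisimple)
    (hq : d.recGL 2 (IrrClass.mk πv) = Quotient.mk (frobSemisimpleWDSetoid F 2) ⟨r', hr'⟩)
    (hN : r'.N = 0) (π' : SmoothIrrep (GL (Fin 1) F)) (χ' : QuasiChar F)
    (hπ' : ∀ (g : GL (Fin 1) F) (v : π'.V),
      π'.ρ g v = ((χ' (Matrix.GeneralLinearGroup.det g) : ℂˣ) : ℂ) • v)
    (θ : WeilGroup F →* ℂˣ) (x : Fin 2 → ℂ) (hx : x ≠ 0)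
    (hρx : ∀ w, r'.ρ w x = ((θ w : ℂˣ) : ℂ) • x)
    (hθ : ∀ u ∈ WeilGroup.inertia F, ((θ u : ℂˣ) : ℂ) * ((χ' (d.artin.artin u) : ℂˣ) : ℂ) = 1)
    [MeasurableSpace (GL (Fin 1) F ⧸ upperUnitriangular (Fin 1) F)]
    [BorelSpace (GL (Fin 1) F ⧸ upperUnitriangular (Fin 1) F)]
    (ν : Measure (GL (Fin 1) F ⧸ upperUnitriangular (Fin 1) F))
    [SMulInvariantMeasure (GL (Fin 1) F) (GL (Fin 1) F ⧸ upperUnitriangular (Fin 1) F) ν]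
    [IsFiniteMeasureOnCompacts ν] [ν.IsOpenPosMeasure] :
    ∃ P : ℂ[X], HasRSLFactor Nat.one_lt_two πv.ρ π'.ρ ψ ν P ∧ 1 ≤ P.natDegree := by
  classical
  haveI : Nontrivial π'.V := Module.nontrivial_of_finrank_eq_succ π'.finrank_eq_one_glOne
  have hgen' : IsGeneric π'.ρ ψ⁻¹ := isGeneric_of_fin_one _ _
  -- (iii-L) at `P₀ :=` the Euler factor itself
  set A₀ := (d.recGL 2 (IrrClass.mk πv)).out.1 with hA₀
  set B₀ := (d.recGL 1 (IrrClass.mk π')).out.1 with hB₀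
  set P₀ : ℂ[X] := (A₀.tprod B₀).eulerFactor d.hn d.hex with hP₀
  have hRS₀ : HasRSLFactor Nat.one_lt_two πv.ρ π'.ρ ψ ν P₀ :=
    (d.isLocalLanglands.lFactor_pairs Nat.one_pos Nat.one_lt_two πv π' ψ hψ hgen hgen' ν P₀).mpr hP₀
  refine ⟨P₀, hRS₀, ?_⟩
  -- (ii): `B₀ ≅ (χ' ∘ artin, N = 0)`
  obtain ⟨e⟩ := d.isLocalLanglands.gl_one χ' π' hπ'
  set φ : (Fin 1 → ℂ) ≃ₗ[ℂ] ℂ := e.toRepEquiv.toLinearEquiv with hφ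
  have hφρ : ∀ (u : WeilGroup F) (y : Fin 1 → ℂ),
      φ (B₀.ρ u y) = (WeilDeligneRep.ofQuasiChar d.hns d.artin χ').ρ u (φ y) := fun u y => by
    rw [hφ, Representation.Equiv.toLinearEquiv_apply, Representation.Equiv.toLinearEquiv_apply]
    exact Representation.IntertwiningMap.isIntertwining _ _ e.toRepEquiv.toIntertwiningMap u y
  have hφN : ∀ y : Fin 1 → ℂ, φ (B₀.N y) = (WeilDeligneRep.ofQuasiChar d.hns d.artin χ').N (φ y) :=
    fun y => LinearMap.congr_fun e.comm_N y
  have hBρ : ∀ (u : WeilGroup F) (y : Fin 1 → ℂ),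
      B₀.ρ u y = ((χ' (d.artin.artin u) : ℂˣ) : ℂ) • y := by
    intro u y
    apply φ.injective
    rw [hφρ, WeilDeligneRep.ofQuasiChar_ρ_apply, map_smul, smul_eq_mul]
  have hBN : ∀ y, B₀.N y = 0 := by
    intro y
    apply φ.injective
    rw [hφN, WeilDeligneRep.ofQuasiChar_N, LinearMap.zero_apply, map_zero]
  -- `r' ≅ A₀`
  have hWA : r'.IsEquivalent A₀ := Quotient.exact (hq.symm.trans (Quotient.out_eq _).symm)
  obtain ⟨e'⟩ := hWA
  set φ' : (Fin 2 → ℂ) ≃ₗ[ℂ] (Fin 2 → ℂ) := e'.toRepEquiv.toLinearEquiv with hφ'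
  have hφ'ρ : ∀ (u : WeilGroup F) (z : Fin 2 → ℂ), φ' (r'.ρ u z) = A₀.ρ u (φ' z) := fun u z => by
    rw [hφ', Representation.Equiv.toLinearEquiv_apply, Representation.Equiv.toLinearEquiv_apply]
    exact Representation.IntertwiningMap.isIntertwining _ _ e'.toRepEquiv.toIntertwiningMap u z
  have hφ'N : ∀ z : Fin 2 → ℂ, φ' (r'.N z) = A₀.N (φ' z) := fun z =>
    LinearMap.congr_fun e'.comm_N z
  have hAN : ∀ z, A₀.N z = 0 := by
    intro z
    obtain ⟨z, rfl⟩ := φ'.surjective z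
    rw [← hφ'N, hN, LinearMap.zero_apply, map_zero]
  -- the invariant line spanned by `φ' x ⊗ φ⁻¹ 1`
  set y₀ : Fin 1 → ℂ := φ.symm 1 with hy₀
  have hφy₀ : φ y₀ = 1 := φ.apply_symm_apply 1
  have hmem : φ' x ⊗ₜ[ℂ] y₀ ∈ (A₀.tprod B₀).inertiaInvariantsKerN := by
    rw [WeilDeligneRep.mem_inertiaInvariantsKerN_iff]
    refine ⟨?_, fun u hu => ?_⟩
    · rw [WeilDeligneRep.tprod_N, LinearMap.add_apply, TensorProduct.map_tmul,
        TensorProduct.map_tmul, hAN, hBN, TensorProduct.zero_tmul, TensorProduct.tmul_zero,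
        add_zero]
    · rw [WeilDeligneRep.tprod_ρ_apply, TensorProduct.map_tmul, ← hφ'ρ, hρx, map_smul, hBρ,
        TensorProduct.smul_tmul_smul, hθ u hu, one_smul]
  have hne : φ' x ⊗ₜ[ℂ] y₀ ≠ 0 := by
    intro h0
    have h1 : (TensorProduct.rid ℂ (Fin 2 → ℂ))
        (TensorProduct.map LinearMap.id (φ : (Fin 1 → ℂ) →ₗ[ℂ] ℂ) (φ' x ⊗ₜ[ℂ] y₀)) = φ' x := by
      rw [TensorProduct.map_tmul, LinearMap.id_apply, LinearEquiv.coe_coe, hφy₀,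
        TensorProduct.rid_tmul, one_smul]
    rw [h0, map_zero, map_zero] at h1
    exact (φ'.map_ne_zero_iff.2 hx) h1.symm
  exact one_le_natDegree_eulerFactor _ d.hn d.hex hmem hne

/-! ### (C2) -/

/-- **(C2) `stub_local1951_llc` — reading the conductor-one shape through the typed LLC.**  Over a
non-archimedean local field `F` with `U¹_F` pro-`p`, let `d` be a local Langlands datum, `π_v` an
irreducible smooth `ψ`-generic representation of `GL₂(F)` with `rec(π_v) = ⟦r'⟧`, `r'` Frobenius-
semisimple, `N = 0`, `r'.ρ = ψ₁ ⊕ ψ₂` on a basis with `ψ₁` unramified, `ψ₂` ramified of finite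
order prime to `p` on inertia.  Then there is a character `χ` of `Fˣ` of conductor exponent ONE
(trivial on `U¹`, non-trivial on `U⁰ = 𝒪ˣ`; namely `χ ∘ d.artin = ψ₂`: local class field theory for
`GL₁` through `ker_artin`, `isOpenQuotientMap_artin`, `image_inertia`, and `χ(U¹)` is a `p`-group
inside `ψ₂(I)`) such that for every invariant measure the JPSS polynomials of `π_v × 1` and of
`π_v × χ⁻¹` have degree `≥ 1` (`lFactor_pairs` at `π' = 1`, `π' = χ⁻¹ ∘ det`; `gl_one`; the Euler
factor of `r' ⊗ 1`, resp. `r' ⊗ (χ⁻¹ ∘ artin)`, sees the inertia-invariant line `b 0`, resp. `b 1`).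
[cite: HarrisTaylorAMS2001, Thm. A (i), (v)] [cite: JacquetLanglands1970, Prop. 3.5, Thm. 2.18]
[cite: TateCorvallis1979, (4.1.6)] -/
theorem stub_local1951_llc : ∀ (F : Type) [Field F] [ValuativeRel F] [TopologicalSpace F]
    [IsNonarchimedeanLocalField F],
    (∀ x ∈ unitFiltration F 1, ∀ N : ℕ, ∃ a : ℕ, x ^ (ringChar 𝓀[F] ^ a) ∈ unitFiltration F N) →
    ∀ (d : LocalLanglandsDatum F) (πv : SmoothIrrep (GL (Fin 2) F)) (ψ : AddChar F Circle),
    ψ.IsContinuousNontrivial → IsGeneric πv.ρ ψ →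
    ∀ (r' : WeilDeligneRep F ℂ (Fin 2 → ℂ)) (hr' : r'.IsFrobSemisimple),
    d.recGL 2 (IrrClass.mk πv) = Quotient.mk (frobSemisimpleWDSetoid F 2) ⟨r', hr'⟩ → r'.N = 0 →
    (∃ (ψ₁ ψ₂ : WeilGroup F →* ℂˣ) (b : Module.Basis (Fin 2) ℂ (Fin 2 → ℂ)),
      (∀ w, r'.ρ w (b 0) = ((ψ₁ w : ℂˣ) : ℂ) • b 0) ∧
      (∀ w, r'.ρ w (b 1) = ((ψ₂ w : ℂˣ) : ℂ) • b 1) ∧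
      (∀ u ∈ WeilGroup.inertia F, ψ₁ u = 1) ∧ (∃ u ∈ WeilGroup.inertia F, ψ₂ u ≠ 1) ∧
      ∃ m : ℕ, 0 < m ∧ ¬ ringChar 𝓀[F] ∣ m ∧ ∀ u ∈ WeilGroup.inertia F, ψ₂ u ^ m = 1) →
    ∃ χ : Fˣ →* ℂˣ, (∀ x ∈ unitFiltration F 1, χ x = 1) ∧ (∃ x ∈ unitFiltration F 0, χ x ≠ 1) ∧
      (∀ [MeasurableSpace (GL (Fin 1) F ⧸ upperUnitriangular (Fin 1) F)]
        [BorelSpace (GL (Fin 1) F ⧸ upperUnitriangular (Fin 1) F)]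
        (ν : Measure (GL (Fin 1) F ⧸ upperUnitriangular (Fin 1) F))
        [SMulInvariantMeasure (GL (Fin 1) F) (GL (Fin 1) F ⧸ upperUnitriangular (Fin 1) F) ν]
        [IsFiniteMeasureOnCompacts ν] [ν.IsOpenPosMeasure],
        ∃ P : ℂ[X], HasRSLFactor Nat.one_lt_two πv.ρ (Representation.trivial ℂ (GL (Fin 1) F) ℂ)
          ψ ν P ∧ 1 ≤ P.natDegree) ∧
      (∀ [MeasurableSpace (GL (Fin 1) F ⧸ upperUnitriangular (Fin 1) F)]
        [BorelSpace (GL (Fin 1) F ⧸ upperUnitriangular (Fin 1) F)]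
        (ν : Measure (GL (Fin 1) F ⧸ upperUnitriangular (Fin 1) F))
        [SMulInvariantMeasure (GL (Fin 1) F) (GL (Fin 1) F ⧸ upperUnitriangular (Fin 1) F) ν]
        [IsFiniteMeasureOnCompacts ν] [ν.IsOpenPosMeasure],
        ∃ P : ℂ[X], HasRSLFactor Nat.one_lt_two πv.ρ (glOneRep χ⁻¹) ψ ν P ∧ 1 ≤ P.natDegree) := by
  intro F _ _ _ _ hproP d πv ψ hψ hgen r' hr' hq hN hshape
  obtain ⟨ψ₁, ψ₂, b, hb0, hb1, hψ₁, ⟨u₀, hu₀, hψ₂u₀⟩, m, -, hpm, hψ₂m⟩ := hshape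
  classical
  haveI : IsTopologicalGroup (WeilGroup F) := WeilGroup.isTopologicalGroup_holds F
  -- `ker ψ₂` is open: `ψ₂` is trivial where `r'.ρ` is
  have hker : IsOpen (ψ₂.ker : Set (WeilGroup F)) := by
    obtain ⟨U, -, hUo, hρU⟩ := r'.isContinuous
    refine Subgroup.isOpen_mono (fun u hu => ?_) hUo
    rw [MonoidHom.mem_ker]
    have h1 : ((ψ₂ u : ℂˣ) : ℂ) • b 1 = ((1 : ℂˣ) : ℂ) • b 1 := by
      rw [← hb1 u, hρU u hu, Module.End.one_apply, Units.val_one, one_smul]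
    exact Units.val_injective (smul_left_injective ℂ (b.ne_zero 1) h1)
  -- `ψ₂ = χ ∘ artin` (local class field theory for `GL₁`)
  set ψ₂t : WeilGroup F →ₜ* ℂˣ := ⟨ψ₂, continuous_monoidHom_of_isOpen_ker ψ₂ hker⟩ with hψ₂t
  obtain ⟨χq, hχq⟩ := d.artin.recGL1_surjective ψ₂t
  have hχw : ∀ w : WeilGroup F, (χq : Fˣ →* ℂˣ) (d.artin.artin w) = ψ₂ w := fun w => by
    have h := congr($hχq w)
    rw [LocalArtinData.recGL1_apply] at h
    exact h
  -- `artin(I_F) = 𝒪ˣ = U⁰`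
  have hunit : ∀ x : Fˣ, normAbs F (x : F) = 1 →
      ∃ u ∈ WeilGroup.inertia F, d.artin.artin u = x := by
    intro x hx
    have hx' : x ∈ (valuation F).valuationSubring.unitGroup := by
      rw [Valuation.mem_unitGroup_iff, ← normAbs_eq_one_iff_valuation_eq_one]
      exact hx
    rw [← d.artin.image_inertia, Subgroup.mem_map] at hx'
    exact hx'
  have hnorm : ∀ u ∈ WeilGroup.inertia F, normAbs F ((d.artin.artin u : Fˣ) : F) = 1 := by
    intro u hu
    have h : d.artin.artin u ∈ (valuation F).valuationSubring.unitGroup := by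
      rw [← d.artin.image_inertia]
      exact Subgroup.mem_map_of_mem _ hu
    rw [normAbs_eq_one_iff_valuation_eq_one, ← Valuation.mem_unitGroup_iff]
    exact h
  refine ⟨(χq : Fˣ →* ℂˣ), fun x hx => ?_, ⟨d.artin.artin u₀, ?_, ?_⟩, ?_, ?_⟩
  · -- trivial on `U¹`: `χ(x)^{p^a} = 1 = χ(x)^m` with `gcd(p^a, m) = 1`
    have hkerχ : ((χq : Fˣ →* ℂˣ).ker : Set Fˣ) ∈ 𝓝 (1 : Fˣ) :=
      (d.hqc χq).mem_nhds (χq : Fˣ →* ℂˣ).ker.one_mem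
    obtain ⟨N, -, hNχ⟩ := exists_unitFiltration_subset hkerχ
    obtain ⟨a, ha⟩ := hproP x hx N
    have h1 : (χq : Fˣ →* ℂˣ) x ^ (ringChar 𝓀[F] ^ a) = 1 := by
      rw [← map_pow]
      exact hNχ ha
    obtain ⟨u, hu, hux⟩ := hunit x hx.1
    have h2 : (χq : Fˣ →* ℂˣ) x ^ m = 1 := by
      rw [← hux, hχw]
      exact hψ₂m u hu
    have hp : (ringChar 𝓀[F]).Prime := CharP.char_is_prime 𝓀[F] _
    have hcop : Nat.Coprime (ringChar 𝓀[F] ^ a) m :=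
      Nat.Coprime.pow_left a ((Nat.Prime.coprime_iff_not_dvd hp).2 hpm)
    have h3 : (χq : Fˣ →* ℂˣ) x ^ Nat.gcd (ringChar 𝓀[F] ^ a) m = 1 := pow_gcd_eq_one.2 ⟨h1, h2⟩
    rwa [Nat.Coprime.gcd_eq_one hcop, pow_one] at h3
  · exact TateDirect.mem_unitFiltration_zero_iff.2 (hnorm u₀ hu₀)
  · rw [hχw]
    exact hψ₂u₀
  · -- `deg L(s, π_v × 1) ≥ 1`: the line `b 0 ⊗ 1`
    intro _ _ ν _ _ _
    let π' : SmoothIrrep (GL (Fin 1) F) :=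
      { V := ℂ
        ρ := Representation.trivial ℂ (GL (Fin 1) F) ℂ
        isIrreducible := isIrreducible_of_finrank_eq_one' _ (Module.finrank_self ℂ)
        isSmooth := fun v => by
          have h : ((Representation.trivial ℂ (GL (Fin 1) F) ℂ).stabilizerSubgroup v :
              Set (GL (Fin 1) F)) = Set.univ := by
            ext g
            simp
          rw [Representation.IsSmoothVector, h]
          exact isOpen_univ }
    exact exists_hasRSLFactor_one_le d πv ψ hψ hgen r' hr' hq hN π' 1 (fun g v => by simp [π'])
      ψ₁ (b 0) (b.ne_zero 0) hb0
      (fun u hu => by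
        change ((ψ₁ u : ℂˣ) : ℂ) * (((1 : Fˣ →* ℂˣ) (d.artin.artin u) : ℂˣ) : ℂ) = 1
        rw [hψ₁ u hu, MonoidHom.one_apply, Units.val_one, one_mul]) ν
  · -- `deg L(s, π_v × χ⁻¹) ≥ 1`: the line `b 1 ⊗ 1`
    intro _ _ ν _ _ _
    have hkero : IsOpen (((χq : Fˣ →* ℂˣ)⁻¹).ker : Set Fˣ) := by
      have h : (((χq : Fˣ →* ℂˣ)⁻¹).ker : Set Fˣ) = ((χq : Fˣ →* ℂˣ).ker : Set Fˣ) := by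
        ext x
        simp [MonoidHom.mem_ker]
      rw [h]
      exact d.hqc χq
    let π' : SmoothIrrep (GL (Fin 1) F) :=
      { V := ℂ
        ρ := glOneRep (χq : Fˣ →* ℂˣ)⁻¹
        isIrreducible := isIrreducible_glOneRep _
        isSmooth := isSmooth_glOneRep hkero }
    exact exists_hasRSLFactor_one_le d πv ψ hψ hgen r' hr' hq hN π' χq⁻¹
      (fun g v => by
        change glOneRep (χq : Fˣ →* ℂˣ)⁻¹ g v =
          ((((χq : Fˣ →* ℂˣ) (Matrix.GeneralLinearGroup.det g))⁻¹ : ℂˣ) : ℂ) * v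
        rw [glOneRep_apply, MonoidHom.inv_apply])
      ψ₂ (b 1) (b.ne_zero 1) hb1
      (fun u hu => by
        change ((ψ₂ u : ℂˣ) : ℂ) * ((((χq : Fˣ →* ℂˣ) (d.artin.artin u))⁻¹ : ℂˣ) : ℂ) = 1
        rw [hχw u, Units.val_inv_eq_inv_val, mul_inv_cancel₀ (Units.ne_zero _)]) ν

end Summit.Langlands.Langlands.Theorems.CorrespondentFingerprint

end
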